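import Mathlib.Tactic
import HarnessLib

/-!
# Kozma–Nitzan's Question 8 at three relays — THEOREM SSC(κ̂): the algebraic kernels (gen 26)

Support file (`--supports stmt-CriticalPhenomena-4575`, closed crux; independent mathematics on Kozma–Nitzan's Question 8,
arXiv:2401.12397 §5.5 p. 36), prover `prim-ineq-gen-6` (gen 26).  No definitions, no named facts, no sorries; standard axioms.
Memo `run/shared/lean/prim/prim-ineq-gen-6/PROOF-SSC-KAPPAHAT-G26.md`.

THEOREM SSC(κ̂) (memo): for every path-end block the depths `j` with `κ̂_j < 0` form an initial segment — the first link of the chain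
SSC(κ̂) → SSC(U) → SSC(δ) → DICHOTOMY D → L0 → C3 (c > 0) of FINDING-G25 §5b.  The proof (memo §2–§4) is: the symmetric form
`κ̂_i = a u L + γ v R − γ a² Φ S u v` (gen-26 toolbox), the channel bound `v < a²ΦS m‴/(Φ+m)` at a negative depth (`vbound_of_neg`, from
`R < a²ΦS u`, `R ≥ (Φ+m)·J‴` and the Chebyshev inequality `J‴ m‴ ≥ u v` on the suffix), the hypothesis-free LEMMA G
`Φπ − c ≥ Φ²m/(Φ+m)` (`lemmaG`, with `c = D(πΦ−m)/Φ`, `D = Φ − π`), which together give `Φ D″ < Φπ − c` and hence the transfer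
inequality (♣″) `a_j u‴ Π′ > A_b R_j v‴` (`club_of_channel_bounds`), and finally the exact step identity of THEOREM 7 (`kappahat_step_identity`)
whose remainder is nonpositive under (♣″).  Every identity and inequality is exact-checked on > 50 000 (block, depth) pairs (lab-g26/q38).
[cite: KozmaNitzan2024, Question 8 (§5.5 p. 36)]
-/

namespace Summit.CriticalPhenomena.PercolationContinuityZ3.Theorems

namespace PocketCert

/-- **LEMMA G (hypothesis-free shallowness floor).**  For the in-moments of a path-end block, `0 ≤ m ≤ π ≤ Φ ≤ 1`, `0 < Φ`, with
`D = Φ − π` and out-defect `c = D(πΦ − m)/Φ`, one has `Φπ − c ≥ Φ²m/(Φ+m)`.  (Proof: `Φπ − c = π² + D m/Φ`, and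
`π² + Dm/Φ − Φ²m/(Φ+m) ≥ π(Φ−π)(1−Φ)/Φ + Φm²/(Φ+m)` when `Φ² − Φ + π ≥ 0`, `≥ π²` otherwise.)
[cite: KozmaNitzan2024, Question 8 (§5.5 p. 36)] -/
theorem lemmaG (Φ π m : ℝ) (hΦ : 0 < Φ) (hΦ1 : Φ ≤ 1) (hm : 0 ≤ m) (hmπ : m ≤ π) (hπΦ : π ≤ Φ) :
    Φ ^ 2 * m / (Φ + m) ≤ Φ * π - (Φ - π) * (π * Φ - m) / Φ := by
  have hΦm : 0 < Φ + m := by linarith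
  have hπ : 0 ≤ π := le_trans hm hmπ
  -- polynomial core: Φ³ m ≤ (Φ²π − (Φ−π)(πΦ−m)) (Φ+m)
  have poly : Φ ^ 2 * m * Φ ≤ (Φ ^ 2 * π - (Φ - π) * (π * Φ - m)) * (Φ + m) := by
    rcases le_or_gt 0 (Φ ^ 2 - Φ + π) with h | h
    · nlinarith [mul_nonneg (sub_nonneg.2 hmπ) h, mul_nonneg hπ (mul_nonneg (sub_nonneg.2 hπΦ) (sub_nonneg.2 hΦ1)),
        mul_nonneg hm hm, mul_pos hΦ hΦm, mul_nonneg hm (sub_nonneg.2 hπΦ), mul_nonneg hm (sub_nonneg.2 hΦ1),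
        mul_nonneg (mul_nonneg hm hm) hΦ.le, mul_nonneg (mul_nonneg hπ (sub_nonneg.2 hπΦ)) (sub_nonneg.2 hΦ1),
        mul_nonneg (mul_nonneg (sub_nonneg.2 hmπ) h) hm, mul_nonneg (mul_nonneg hm hm) (sub_nonneg.2 hΦ1)]
    · nlinarith [mul_nonneg hm (le_of_lt (neg_pos.2 h)), mul_nonneg hπ hπ, mul_nonneg hm hm, mul_pos hΦ hΦm,
        mul_nonneg hm (sub_nonneg.2 hπΦ), mul_nonneg hm (sub_nonneg.2 hΦ1), mul_nonneg (mul_nonneg hπ hπ) hΦ.le,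
        mul_nonneg (mul_nonneg hπ hπ) hm, mul_nonneg (mul_nonneg hm hm) hΦ.le,
        mul_nonneg (mul_nonneg hm (le_of_lt (neg_pos.2 h))) hm]
  have e : Φ * π - (Φ - π) * (π * Φ - m) / Φ = (Φ ^ 2 * π - (Φ - π) * (π * Φ - m)) / Φ := by
    field_simp
  rw [e, div_le_div_iff₀ hΦm hΦ]
  linarith [poly]

/-- **The channel bound at a negative depth.**  If `R < a²·Φ·S·u` (the normalised channel `𝔅 < 1`, forced by `κ̂_i < 0`),
`R ≥ (Φ+m)·J` (from `R_i ≥ K₄ = (Φ+m)(1−Φ)` and `1 − Φ ≥ J‴`) and `J·m₃ ≥ u·v` (Chebyshev on the suffix), with `u, m₃ > 0`,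
`Φ + m > 0`, then `v < a²ΦS·m₃/(Φ+m)`. [cite: KozmaNitzan2024, Question 8 (§5.5 p. 36)] -/
theorem vbound_of_neg (R a Φ S u v J m m₃ : ℝ) (hu : 0 < u) (hm₃ : 0 < m₃) (hΦm : 0 < Φ + m)
    (hR : R < a ^ 2 * Φ * S * u) (hRJ : (Φ + m) * J ≤ R) (hJ : u * v ≤ J * m₃) :
    v < a ^ 2 * Φ * S * m₃ / (Φ + m) := by
  rw [lt_div_iff₀ hΦm]
  -- (Φ+m) u v ≤ (Φ+m) J m₃ ≤ R m₃ < a²ΦS u m₃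
  have h1 : (Φ + m) * (u * v) ≤ (Φ + m) * (J * m₃) := mul_le_mul_of_nonneg_left hJ hΦm.le
  have h2 : (Φ + m) * (J * m₃) ≤ R * m₃ := by nlinarith
  have h3 : R * m₃ < a ^ 2 * Φ * S * u * m₃ := mul_lt_mul_of_pos_right hR hm₃
  nlinarith

/-- **(♣″) from the channel bounds.**  At depth `i = j+1` write the negativity `κ̂_i < 0` as
`a·u·L + γ·v·R − γ·a²·Φ·S·u·v < 0` (`a = a_i`, `γ = γ_i`, `u,v` the channels of `T_{i+1}`, `L = L_i`, `R = R_i`), put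
`ΦD″ := γ·a·Φ·S·v`, and assume `Φ·D″ < P` (`P := Φπ − c`, LEMMA G + `vbound_of_neg`), `L ≥ (1−γ)·P`, `Π ≥ P ≥ 0`,
`R_j ≤ R`, `0 < A ≤ 1` (`A = A_b`, `a = a_j·A`), `a_j, γ, u, v > 0`.  Then `a_j·u·Π′ > A·R_j·v` (the symbols `Φ, S` enter only through the
hypotheses).
[cite: KozmaNitzan2024, Question 8 (§5.5 p. 36)] -/
theorem club_of_channel_bounds (aj A γ Φ S u v L R Rj P Pp : ℝ) (haj : 0 < aj) (hA : 0 < A) (hA1 : A ≤ 1) (hγ : 0 < γ)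
    (hu : 0 < u) (hv : 0 < v) (hRj : 0 ≤ Rj) (hRjR : Rj ≤ R)
    (hneg : (aj * A) * u * L + γ * v * R - γ * (aj * A) ^ 2 * Φ * S * u * v < 0)
    (hD : γ * (aj * A) * Φ * S * v < P) (hL : (1 - γ) * P ≤ L) (hPp : P ≤ Pp) (hP : 0 ≤ P) :
    A * Rj * v < aj * u * Pp := by
  set den := γ * (aj * A) ^ 2 * Φ * S * v - aj * A * L with hden_def
  -- (i) γ v Rj ≤ γ v R < u·den  (this is `hneg` rearranged)
  have hi : γ * v * Rj < u * den := by
    have e : u * den = γ * (aj * A) ^ 2 * Φ * S * u * v - aj * A * u * L := by rw [hden_def]; ring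
    have : γ * v * Rj ≤ γ * v * R := mul_le_mul_of_nonneg_left hRjR (mul_nonneg hγ.le hv.le)
    linarith
  -- (ii) A·den < aj·γ·Pp, from Φ D″ < P ≤ Pp, L ≥ (1−γ)P and A, γ ≤ 1
  have h2 : A ^ 2 * P ≤ γ * Pp + A ^ 2 * L := by
    have hA2 : 0 ≤ A ^ 2 := sq_nonneg A
    have hA21 : A ^ 2 ≤ 1 := by nlinarith
    nlinarith [mul_nonneg hγ.le (sub_nonneg.2 hPp), mul_nonneg hA2 (sub_nonneg.2 hL), mul_nonneg (mul_nonneg hγ.le (sub_nonneg.2 hA21)) hP]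
  have hii : A * den < aj * γ * Pp := by
    have e : A * den = aj * A ^ 2 * (γ * (aj * A) * Φ * S * v) - aj * A ^ 2 * L := by rw [hden_def]; ring
    have hajA2 : 0 < aj * A ^ 2 := by positivity
    have h3 : aj * A ^ 2 * (γ * (aj * A) * Φ * S * v) < aj * A ^ 2 * P := mul_lt_mul_of_pos_left hD hajA2
    nlinarith [mul_le_mul_of_nonneg_left h2 haj.le]
  -- combine: A γ v Rj < A u den < u aj γ Pp, then divide by γ
  have hdenpos : 0 < den := by
    by_contra hc
    have hc' : den ≤ 0 := not_lt.mp hc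
    have : u * den ≤ 0 := mul_nonpos_of_nonneg_of_nonpos hu.le hc'
    have : 0 ≤ γ * v * Rj := mul_nonneg (mul_nonneg hγ.le hv.le) hRj
    linarith
  have h4 : A * (γ * v * Rj) < A * (u * den) := mul_lt_mul_of_pos_left hi hA
  have h5 : u * (A * den) < u * (aj * γ * Pp) := mul_lt_mul_of_pos_left hii hu
  have h6 : γ * (A * Rj * v) < γ * (aj * u * Pp) := by nlinarith
  exact lt_of_mul_lt_mul_left h6 hγ.le

/-- **THEOREM 7's exact step identity** (depth `j → j+1`, vertex `b = b_{j+1}` with marks `A, C`, edge weight `s = s_{j+2}`,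
`u, v, mt` the channels and `m̃`-weight of `T_{j+2}`, `S = S_{j+1}`; the channels of `T_{j+1}` are `C((1−A)mt + s u)` and
`A((1−C)mt + s v)`; `L' = L + γ(1−C)Π`, `R' = R + a(1−A)X`).  Multiplying `κ̂_j` by `A`:
`A·κ̂_j = s·[κ̂_{j+1} − A a u (1−C)(L+γΠ) + γ v (A²R − C R')] + A·mt·ℓ₀ − A·mt²·γa²ΦS·A·C(1−A)(1−C)` with
`ℓ₀ = aC(1−A)L + γA(1−C)R − γa²Φ(S s)AC[(1−A)v + (1−C)u]`. [cite: KozmaNitzan2024, Question 8 (§5.5 p. 36)] -/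
theorem kappahat_step_identity (a γ Φ S s A C L Pp R X u v mt : ℝ) :
    A * (a * (C * ((1 - A) * mt + s * u)) * L + γ * (A * ((1 - C) * mt + s * v)) * R
        - γ * a ^ 2 * Φ * S * (C * ((1 - A) * mt + s * u)) * (A * ((1 - C) * mt + s * v)))
      = s * ((a * A * u * (L + γ * (1 - C) * Pp) + γ * C * v * (R + a * (1 - A) * X)
              - γ * C * (a * A) ^ 2 * Φ * (S * s) * u * v)
            - A * a * u * (1 - C) * (L + γ * Pp) + γ * v * (A ^ 2 * R - C * (R + a * (1 - A) * X)))
        + A * mt * (a * C * (1 - A) * L + γ * A * (1 - C) * R - γ * a ^ 2 * Φ * (S * s) * A * C * ((1 - A) * v + (1 - C) * u))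
        - A * mt ^ 2 * (γ * a ^ 2 * Φ * S * A * C * (1 - A) * (1 - C)) := by
  ring

end PocketCert

end Summit.CriticalPhenomena.PercolationContinuityZ3.Theorems
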